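import Summits.AtomisticToContinuum.Crystallization.Theses.SoftAnnulusKernel
import Summits.AtomisticToContinuum.Crystallization.Theorems.TwoCentreKissingKernelKernelGlue

/-!
# `KernelGlueLocal` for route SoftAnnulusKernel (item stmt-AtomisticToContinuum-18405)

`SoftLocalTwelveFourCommon → RobustTangencyBound → GapFreeShellRigidity`: the finite-set bookkeeping of
`kernelGlue_proof` (route TwoCentreKissingKernel, item stmt-12083) re-run from the LOCAL rung — the soft
four-common lemma is only ever applied at the kernel's centre `x`, all of whose soft neighbours are softly
twelve-coordinated by the kernel's hypothesis, which is exactly the rung's extra hypothesis on `Z = S ∩ B(x,4)`.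
-/

namespace Summit.AtomisticToContinuum.Crystallization.Theorems

open Summit.AtomisticToContinuum.Crystallization.Theses.SoftAnnulusKernel

/-- **Kernel glue from the rung**: `SoftLocalTwelveFourCommon → RobustTangencyBound →
GapFreeShellRigidity` (sorry-free; the rung replaces the crux in the cone of the kernel crux
`GapFreeShellRigidity`, stmt-AtomisticToContinuum-12078). -/
theorem kernelGlueLocal_proof : KernelGlueLocal := by
  intro hLoc hRob η hη0 hη1 S x hx hsep h12
  -- the soft shell of `x`
  set N : Set (EuclideanSpace ℝ (Fin 3)) := {y ∈ S | y ≠ x ∧ dist x y ≤ 1 + η} with hN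
  have hNcard : N.ncard = 12 := by
    have e : N = {w ∈ S | w ≠ x ∧ dist x w ≤ 1 + η} := rfl
    exact h12 x hx (by rw [dist_self]; linarith)
  have hNfin : N.Finite := Set.finite_of_ncard_ne_zero (by rw [hNcard]; norm_num)
  obtain ⟨T, hT⟩ : ∃ T : Finset (EuclideanSpace ℝ (Fin 3)),
      T = hNfin.toFinset.image (fun y => y - x) := ⟨_, rfl⟩
  have hmemT : ∀ t, t ∈ T ↔ ∃ y ∈ N, y - x = t := by
    intro t
    simp only [hT, Finset.mem_image, Set.Finite.mem_toFinset]
  have hTcard : T.card = 12 := by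
    rw [hT, Finset.card_image_of_injective _ sub_left_injective,
      ← Set.ncard_eq_toFinset_card N hNfin, hNcard]
  -- norms of the translated shell
  have hnorm : ∀ t ∈ T, 1 - η ≤ ‖t‖ ∧ ‖t‖ ≤ 1 + η := by
    intro t ht
    obtain ⟨y, ⟨hyS, hyx, hdy⟩, rfl⟩ := (hmemT t).1 ht
    rw [← dist_eq_norm, dist_comm]
    exact ⟨hsep x hx y hyS (by rw [dist_self]; norm_num) (by linarith) hyx.symm, hdy⟩
  -- separation of the translated shell
  have hsepT : ∀ t ∈ T, ∀ t' ∈ T, t ≠ t' → 1 - η ≤ dist t t' := by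
    intro t ht t' ht' hne
    obtain ⟨y, ⟨hyS, -, hdy⟩, rfl⟩ := (hmemT t).1 ht
    obtain ⟨y', ⟨hy'S, -, hdy'⟩, rfl⟩ := (hmemT t').1 ht'
    rw [dist_sub_right]
    exact hsep y hyS y' hy'S (by linarith) (by linarith) (fun h => hne (by rw [h]))
  -- the local patch `Z = S ∩ B(x, 4)` and the rung's hypotheses on it
  set Z : Set (EuclideanSpace ℝ (Fin 3)) := {w ∈ S | dist x w ≤ 4} with hZ
  have hZsep : ∀ u ∈ Z, ∀ v ∈ Z, u ≠ v → 1 - η ≤ dist u v :=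
    fun u hu v hv huv => hsep u hu.1 v hv.1 hu.2 hv.2 huv
  have hxZ : x ∈ Z := ⟨hx, by rw [dist_self]; norm_num⟩
  have hAllZ : ∀ u ∈ Z, dist u x ≤ 1 + η → {w ∈ Z | w ≠ u ∧ dist w u ≤ 1 + η}.ncard = 12 := by
    intro u hu hux
    have hux' : dist x u ≤ 1 + η := by rwa [dist_comm]
    have e : {w ∈ Z | w ≠ u ∧ dist w u ≤ 1 + η} = {w ∈ S | w ≠ u ∧ dist u w ≤ 1 + η} := by
      ext w
      constructor
      · rintro ⟨⟨hwS, -⟩, hwu, hd⟩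
        exact ⟨hwS, hwu, by rwa [dist_comm]⟩
      · rintro ⟨hwS, hwu, hd⟩
        refine ⟨⟨hwS, ?_⟩, hwu, by rwa [dist_comm]⟩
        calc dist x w ≤ dist x u + dist u w := dist_triangle x u w
          _ ≤ 4 := by linarith
    rw [e]
    exact h12 u hu.1 hux'
  -- every shell point has at least four soft-tangent partners in the shell
  have hfib : ∀ a ∈ T, 4 ≤ {b ∈ (T : Set (EuclideanSpace ℝ (Fin 3))) |
      b ≠ a ∧ dist a b ≤ 1 + η}.ncard := by
    intro a ha
    obtain ⟨y, ⟨hyS, hyx, hdy⟩, rfl⟩ := (hmemT a).1 ha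
    have hyZ : y ∈ Z := ⟨hyS, by linarith⟩
    have hC := hLoc η hη0 hη1 Z hZsep x hxZ hAllZ y hyZ hyx.symm hdy
    have hsub : (fun w => w - x) '' {w ∈ Z | w ≠ x ∧ w ≠ y ∧ dist w x ≤ 1 + η ∧ dist w y ≤ 1 + η}
        ⊆ {b ∈ (T : Set (EuclideanSpace ℝ (Fin 3))) | b ≠ y - x ∧ dist (y - x) b ≤ 1 + η} := by
      rintro _ ⟨w, ⟨⟨hwS, -⟩, hwx, hwy, hdx, hdy'⟩, rfl⟩
      refine ⟨?_, fun h => hwy (sub_left_injective h), ?_⟩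
      · exact (Finset.mem_coe).2 ((hmemT _).2 ⟨w, ⟨hwS, hwx, by rwa [dist_comm]⟩, rfl⟩)
      · rw [dist_sub_right, dist_comm]
        exact hdy'
    have hfinT : {b ∈ (T : Set (EuclideanSpace ℝ (Fin 3))) |
        b ≠ y - x ∧ dist (y - x) b ≤ 1 + η}.Finite :=
      (Finset.finite_toSet T).subset (fun b hb => hb.1)
    calc 4 ≤ {w ∈ Z | w ≠ x ∧ w ≠ y ∧ dist w x ≤ 1 + η ∧ dist w y ≤ 1 + η}.ncard := hC
      _ = ((fun w => w - x) ''
            {w ∈ Z | w ≠ x ∧ w ≠ y ∧ dist w x ≤ 1 + η ∧ dist w y ≤ 1 + η}).ncard :=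
          (Set.ncard_image_of_injective _ sub_left_injective).symm
      _ ≤ _ := Set.ncard_le_ncard hsub hfinT
  have hpairs : 48 ≤ Nat.card {q : ↥T × ↥T // q.1 ≠ q.2 ∧
      dist (q.1 : EuclideanSpace ℝ (Fin 3)) q.2 ≤ 1 + η} := by
    have := kernelGlue_card_pairs_ge T (1 + η) 4 hfib
    rw [hTcard] at this
    omega
  refine ⟨T, ?_, hRob η hη0 hη1 T hTcard hnorm hsepT hpairs⟩
  rw [hT, Finset.coe_image, Set.Finite.coe_toFinset]


end Summit.AtomisticToContinuum.Crystallization.Theorems
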